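import Summits.QuantumFields.BalabanUV.T4Continuum.Support.NE7StraightTowerCurlEnergy
import Summits.QuantumFields.BalabanUV.T4Continuum.Support.NE7RadIterUniform
import Mathlib.Analysis.Complex.ExponentialBounds
import HarnessLib

/-!
# NE7StraightTowerCurlEnergyD4 — THE j-UNIFORM EVALUATION IN d = 4: for a class configuration (fine plaquette radius `ε·L^{−2(j+1)}`) the straight tower's coarse Maxwell energy obeys
# `√E_{j+1} ≤ √E_0 + 6·eC(4,L,ν)·ε·L^{−(j+1)}·√N_0` — the remainder is `O(ε)` times the SCALED fine mass root `L^{−(j+1)}√N_0`, UNIFORMLY IN j AND IN THE VOLUME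
# (lineage `b2b-balaban-t4-ne7-p1`, gen 117, file F5; ROAD-G116 §7∕§9 (G1) concluded for the straight part)

Cell `pub-balaban`, rung (B)+1 sub-cell t4, CRUX PROVER NE7 #1 (OWNER of row NE7), generation 117.  F4 ✓ `NE7StraightTowerCurlEnergy.sqrt_curl_energy_QbarIter_le` bounds the root energy of the
straight double-bar tower by `√(L⁴∕L^d)^{j+1}√E_0 + towerB d L ν j x·√N_0` with the explicit recursion `towerB`.  THIS FILE evaluates `towerB`: §1 the closed form as a SUM OVER LEVELS against any
majorant `g` of the radii `radIter m x` (`towerB_le_sum`); §2 the product of the mass factors `Π_{l<i}(ρ_N + mC·g l) ≤ ρ_N^i·exp(Σ_l mC·g l∕ρ_N)`; §3 in `d = 4` (`ρ_E = 1`, `ρ_N = L⁻¹`) with the class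
radii `radIter m (ε·L^{−2(j+1)}) ≤ 2ε·L^{−2(j+1−m)}` (✓ `NE7RadIterUniform.levelSmall_of_class_radius`): **`towerB_class_le`** `towerB 4 L ν j (ε·L^{−2(j+1)}) ≤ 6·eC·ε·L^{−(j+1)}` under the
smallness lines `4ε·radD·L^{−4} ≤ 1`, `twoLevelSmall·2ε·L^{−2} ≤ 1`, `8·L·mC·ε·L^{−2} ≤ 1` (geometric series `Σ_{k≥1} L^{−k} ≤ 1` and `Π(1+u) ≤ e^{Σu} ≤ e ≤ 3`), and the headline
**`sqrt_curl_energy_QbarIter_le_class_d4`**: for `U` unitary `(tower L N (j+1))`-periodic with `SmallField U (ε·L^{−2(j+1)})` and `Y` periodic,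
`√(Σ_{P∈perWin N} nhsNormSq (curl (cavgIter L (j+1) U) (QbarIter L (j+1) U Y) P)) ≤ √(Σ_p nhsNormSq (curl U Y p)) + 6·eC 4 L ν·ε·(L⁻¹)^{j+1}·√(Σ_b nhsNormSq (Y b))`.
HONEST FRAMING: real-analysis bookkeeping of OUR recursion + F4; constants not optimised; nothing of Bałaban's asserted; the statement is for the STRAIGHT part `QbarIter` of the linearised
k-fold average (the frame∕gauge part `gaugeDir (framePotW)` is exact-commutator-valued under `curl` and is NOT controlled by energy + scaled mass — memo); NOT (G′), NOT NE7 as a spine node;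
spine 0∕9; finite T⁴ rung (B)+1 — NOT infinite volume, NOT mass gap, NOT BetaPertH, NOT Clay.
-/

set_option autoImplicit false

open scoped BigOperators Matrix.Norms.L2Operator
open NormedSpace Finset

namespace Summit.QuantumFields.BalabanUV.T4Continuum.NE7StraightTowerCurlEnergyD4

open Literature.MathematicalPhysics.QuantumFieldTheory.Balaban1983to89
open B7Prop1Explicit B7Prop2Explicit MatrixLog UnitaryModel
open T4AveragingDeficitWall (IsUnitaryCfg SmallField curl)
open T4AveragingDeficitWallBoundary (IsPeriodicCfg periodBox)
open AveragingDeficitPeriodicCounting (IsPeriodicDir)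
open AveragingDeficitTwoLevelPrep (twoLevelSmall prop1Radius)
open AveragingDeficitMultiLevelPrep (cavgIter tower LevelSmall radIter prop1Radius_nonneg)
open MatrixNorms (nhsNormSq)
open MinimalActionLevels (perWin)
open NE3TangentCovariantTower (QbarIter)
open NE7RadIterUniform (radD radIter_nonneg levelSmall_of_class_radius)
open NE7StraightTowerCurlEnergy (eC mC towerB eC_nonneg mC_nonneg towerB_nonneg sqrt_curl_energy_QbarIter_le)

noncomputable section

variable {d : ℕ} {n : Type*} [Fintype n] [DecidableEq n]

/-! ## §1 `towerB` as a sum over the levels against a majorant of the radii -/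

omit [Fintype n] [DecidableEq n] in
/-- **CLOSED-FORM MAJORANT**: if `radIter m x ≤ g m` for all `m ≤ j` (with `x ≥ 0`, `g ≥ 0`), then
`towerB d L ν j x ≤ Σ_{i≤j} ρ_E^{j−i}·eC·g i·Π_{l<i}(ρ_N + mC·g l)`, `ρ_E = √(L⁴∕L^d)`, `ρ_N = √(L²∕L^d)`. [folklore] -/
theorem towerB_le_sum (d L : ℕ) {ν : ℝ} :
    ∀ (j : ℕ) {x : ℝ} (g : ℕ → ℝ), 0 ≤ x → (∀ m, 0 ≤ g m) → (∀ m ≤ j, radIter d L m x ≤ g m) →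
      towerB d L ν j x ≤ ∑ i ∈ Finset.range (j + 1), Real.sqrt ((L : ℝ) ^ 4 / (L : ℝ) ^ d) ^ (j - i) * (eC d L ν * g i)
        * ∏ l ∈ Finset.range i, (Real.sqrt ((L : ℝ) ^ 2 / (L : ℝ) ^ d) + mC d L ν * g l)
  | 0, x, g, hx, hg, hrad => by
      have h0 := hrad 0 le_rfl
      simp only [radIter] at h0
      unfold towerB
      simp only [zero_add, Finset.sum_range_one, Nat.sub_zero, pow_zero, one_mul, Finset.range_zero, Finset.prod_empty, mul_one]
      exact mul_le_mul_of_nonneg_left h0 (eC_nonneg d L)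
  | j + 1, x, g, hx, hg, hrad => by
      set ρE : ℝ := Real.sqrt ((L : ℝ) ^ 4 / (L : ℝ) ^ d) with hρE
      set ρN : ℝ := Real.sqrt ((L : ℝ) ^ 2 / (L : ℝ) ^ d) with hρN
      have hρE0 : 0 ≤ ρE := Real.sqrt_nonneg _
      have hρN0 : 0 ≤ ρN := Real.sqrt_nonneg _
      have heC := eC_nonneg d L (ν := ν)
      have hmC := mC_nonneg d L (ν := ν)
      -- the shifted majorant for the tower above the first step
      have hx1 : 0 ≤ prop1Radius d L x := prop1Radius_nonneg hx
      have hrad1 : ∀ m ≤ j, radIter d L m (prop1Radius d L x) ≤ g (m + 1) := fun m hm => by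
        have h := hrad (m + 1) (by omega)
        simpa [radIter] using h
      have ih := towerB_le_sum d L (ν := ν) j (fun m => g (m + 1)) hx1 (fun m => hg (m + 1)) hrad1
      have h0 : x ≤ g 0 := by have h := hrad 0 (by omega); simpa [radIter] using h
      have hfac0 : 0 ≤ ρN + mC d L ν * x := by positivity
      have hfac : ρN + mC d L ν * x ≤ ρN + mC d L ν * g 0 := by nlinarith
      -- unfold one step of the recursion
      show ρE ^ (j + 1) * (eC d L ν * x) + towerB d L ν j (prop1Radius d L x) * (ρN + mC d L ν * x) ≤ _
      have hS0 : 0 ≤ ∑ i ∈ Finset.range (j + 1), ρE ^ (j - i) * (eC d L ν * g (i + 1)) * ∏ l ∈ Finset.range i, (ρN + mC d L ν * g (l + 1)) :=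
        Finset.sum_nonneg fun i _ => mul_nonneg (mul_nonneg (pow_nonneg hρE0 _) (mul_nonneg heC (hg _)))
          (Finset.prod_nonneg fun l _ => by have := hg (l + 1); positivity)
      calc ρE ^ (j + 1) * (eC d L ν * x) + towerB d L ν j (prop1Radius d L x) * (ρN + mC d L ν * x)
          ≤ ρE ^ (j + 1) * (eC d L ν * g 0)
            + (∑ i ∈ Finset.range (j + 1), ρE ^ (j - i) * (eC d L ν * g (i + 1)) * ∏ l ∈ Finset.range i, (ρN + mC d L ν * g (l + 1))) * (ρN + mC d L ν * g 0) := by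
            refine add_le_add (mul_le_mul_of_nonneg_left (mul_le_mul_of_nonneg_left h0 heC) (pow_nonneg hρE0 _)) ?_
            exact mul_le_mul ih hfac hfac0 hS0
        _ = ∑ i ∈ Finset.range (j + 1 + 1), ρE ^ (j + 1 - i) * (eC d L ν * g i) * ∏ l ∈ Finset.range i, (ρN + mC d L ν * g l) := by
            rw [Finset.sum_range_succ' _ (j + 1)]
            simp only [Finset.prod_range_succ', Finset.range_zero, Finset.prod_empty, mul_one, Nat.sub_zero, Nat.add_sub_add_right]
            rw [add_comm, Finset.sum_mul]
            congr 1
            refine Finset.sum_congr rfl fun i _ => ?_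
            ring

/-! ## §2 The mass factors: `Π_{l<i}(ρ_N + mC·g l) ≤ ρ_N^i·e^{(mC∕ρ_N)·Σ_l g l}` -/

omit [Fintype n] [DecidableEq n] in
/-- `Π_{l<i}(ρ + c·g l) ≤ ρ^i·exp((c∕ρ)·Σ_{l<i} g l)` for `ρ > 0`, `c, g ≥ 0` (`1 + u ≤ e^u`). [folklore] -/
theorem prod_add_le_pow_mul_exp {ρ c : ℝ} (hρ : 0 < ρ) (hc : 0 ≤ c) (g : ℕ → ℝ) (hg : ∀ m, 0 ≤ g m) (i : ℕ) :
    ∏ l ∈ Finset.range i, (ρ + c * g l) ≤ ρ ^ i * Real.exp ((c / ρ) * ∑ l ∈ Finset.range i, g l) := by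
  have hfac : ∀ l, ρ + c * g l = ρ * (1 + (c / ρ) * g l) := fun l => by field_simp
  have h1 : ∏ l ∈ Finset.range i, (ρ + c * g l) = ρ ^ i * ∏ l ∈ Finset.range i, (1 + (c / ρ) * g l) := by
    rw [Finset.prod_congr rfl fun l _ => hfac l, Finset.prod_mul_distrib, Finset.prod_const, Finset.card_range]
  rw [h1, Finset.mul_sum, Real.exp_sum]
  refine mul_le_mul_of_nonneg_left ?_ (pow_nonneg hρ.le _)
  refine Finset.prod_le_prod (fun l _ => by have := hg l; positivity) fun l _ => ?_
  have h := Real.add_one_le_exp ((c / ρ) * g l)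
  linarith

/-! ## §3 d = 4 with the class radii -/

omit [Fintype n] [DecidableEq n] in
/-- `Σ_{i≤j} L^{−2(j+1−i)}·L^{−i} ≤ L^{−(j+1)}` for `L ≥ 2` (it equals `L^{−(j+1)}·Σ_{k=1}^{j+1} L^{−k}`). [folklore] -/
theorem sum_geom_d4_le {L : ℝ} (hL : 2 ≤ L) (j : ℕ) :
    ∑ i ∈ Finset.range (j + 1), ((L ^ 2)⁻¹) ^ (j + 1 - i) * (L⁻¹) ^ i ≤ (L⁻¹) ^ (j + 1) := by
  have hL0 : 0 < L := by linarith
  have hq0 : 0 ≤ L⁻¹ := by positivity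
  have hq : L⁻¹ ≤ 1 / 2 := by rw [inv_eq_one_div]; exact one_div_le_one_div_of_le (by norm_num) hL
  -- termwise `(L²)^{-(j+1-i)} L^{-i} = L^{-(j+1)} · L^{-(j+1-i)}`
  have hterm : ∀ i ∈ Finset.range (j + 1), ((L ^ 2)⁻¹) ^ (j + 1 - i) * (L⁻¹) ^ i = (L⁻¹) ^ (j + 1) * (L⁻¹) ^ (j + 1 - i) := by
    intro i hi
    have hij : i ≤ j + 1 := by have := Finset.mem_range.mp hi; omega
    have e1 : ((L ^ 2)⁻¹ : ℝ) = L⁻¹ * L⁻¹ := by rw [pow_two, mul_inv]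
    rw [e1, mul_pow, mul_assoc, ← pow_add, show j + 1 - i + i = j + 1 by omega, mul_comm]
  rw [Finset.sum_congr rfl hterm, ← Finset.mul_sum]
  refine mul_le_of_le_one_right (pow_nonneg hq0 _) ?_
  -- `Σ_{i≤j} q^{j+1-i} = Σ_{k=1}^{j+1} q^k ≤ Σ_{k<j+2} q^k - 1 ≤ 2 - 1`
  have hre : ∑ i ∈ Finset.range (j + 1), (L⁻¹) ^ (j + 1 - i) = ∑ k ∈ Finset.range (j + 1), (L⁻¹) ^ (k + 1) := by
    rw [← Finset.sum_range_reflect]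
    refine Finset.sum_congr rfl fun k hk => ?_
    have := Finset.mem_range.mp hk
    congr 1; omega
  rw [hre]
  have hgeom := NE7RadIterUniform.geom_sum_le_two hq0 hq (j + 2)
  rw [Finset.sum_range_succ'] at hgeom
  simp only [pow_zero] at hgeom
  linarith

omit [Fintype n] [DecidableEq n] in
/-- **THE CLASS-RADIUS EVALUATION IN d = 4**: for `L ≥ 2`, `0 ≤ ε`, `0 ≤ ν` and the smallness lines `4ε·radD 4 L·L^{−4} ≤ 1`, `twoLevelSmall 4 L·2ε·L^{−2} ≤ 1`, `8·L·mC 4 L ν·ε·L^{−2} ≤ 1`: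
`towerB 4 L ν j (ε·(L²)⁻¹^{j+1}) ≤ 6·eC 4 L ν·ε·(L⁻¹)^{j+1}` for EVERY `j`. [folklore] -/
theorem towerB_class_le {L : ℕ} (hL : 2 ≤ L) {ν ε : ℝ} (hε : 0 ≤ ε)
    (hεD : 4 * ε * radD 4 L * (((L : ℝ) ^ 2)⁻¹) ^ 2 ≤ 1) (hεT : twoLevelSmall 4 L * (2 * ε * ((L : ℝ) ^ 2)⁻¹) ≤ 1)
    (hεM : 8 * (L : ℝ) * mC 4 L ν * ε * ((L : ℝ) ^ 2)⁻¹ ≤ 1) (j : ℕ) :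
    towerB 4 L ν j (ε * (((L : ℝ) ^ 2)⁻¹) ^ (j + 1)) ≤ 6 * eC 4 L ν * ε * ((L : ℝ)⁻¹) ^ (j + 1) := by
  have hLr : (2 : ℝ) ≤ L := by exact_mod_cast hL
  have hL0 : (0 : ℝ) < L := by linarith
  set q : ℝ := ((L : ℝ) ^ 2)⁻¹ with hq
  have hq0 : 0 ≤ q := by positivity
  have heC := eC_nonneg 4 L (ν := ν)
  have hmC := mC_nonneg 4 L (ν := ν)
  -- ρ_E = 1, ρ_N = L⁻¹ in d = 4
  have hLne : (L : ℝ) ≠ 0 := hL0.ne'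
  have hρE : Real.sqrt ((L : ℝ) ^ 4 / (L : ℝ) ^ 4) = 1 := by rw [div_self (pow_ne_zero 4 hLne), Real.sqrt_one]
  have hρN : Real.sqrt ((L : ℝ) ^ 2 / (L : ℝ) ^ 4) = (L : ℝ)⁻¹ := by
    rw [show (L : ℝ) ^ 2 / (L : ℝ) ^ 4 = ((L : ℝ)⁻¹) ^ 2 by field_simp, Real.sqrt_sq (by positivity)]
  -- the radii majorant
  obtain ⟨-, hrad⟩ := levelSmall_of_class_radius (d := 4) hL hε hεD hεT j
  set g : ℕ → ℝ := fun m => 2 * ε * q ^ (j + 1 - m) with hg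
  have hg0 : ∀ m, 0 ≤ g m := fun m => by positivity
  have hradg : ∀ m ≤ j, radIter 4 L m (ε * q ^ (j + 1)) ≤ g m := fun m hm => hrad m (by omega)
  have hsum := towerB_le_sum 4 L (ν := ν) j g (by positivity) hg0 hradg
  rw [hρE, hρN] at hsum
  refine hsum.trans ?_
  simp only [one_pow, one_mul]
  -- the mass factors: `Π_{l<i}(L⁻¹ + mC g l) ≤ L^{-i}·3`
  have hU : ∀ i ≤ j + 1, (mC 4 L ν / (L : ℝ)⁻¹) * ∑ l ∈ Finset.range i, g l ≤ 1 := by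
    intro i hi
    have hgsum : ∑ l ∈ Finset.range i, g l ≤ 2 * ε * (2 * q) := by
      -- `Σ_{l<i} q^{j+1-l} ≤ Σ_{k≥1} q^k ≤ 2q` (q ≤ 1/4)
      have hq4 : q ≤ 1 / 4 := by
        rw [hq]; have : (4 : ℝ) ≤ (L : ℝ) ^ 2 := by nlinarith
        calc ((L : ℝ) ^ 2)⁻¹ ≤ (4 : ℝ)⁻¹ := by exact inv_anti₀ (by norm_num) this
          _ = 1 / 4 := by norm_num
      have hterm : ∀ l ∈ Finset.range i, q ^ (j + 1 - l) ≤ q * q ^ (j - l) := by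
        intro l hl
        have hl' : l ≤ j := by have := Finset.mem_range.mp hl; omega
        rw [← pow_succ', show j - l + 1 = j + 1 - l by omega]
      have h1 : ∑ l ∈ Finset.range i, q ^ (j + 1 - l) ≤ q * ∑ l ∈ Finset.range i, q ^ (j - l) := by
        rw [Finset.mul_sum]; exact Finset.sum_le_sum hterm
      have h2 : ∑ l ∈ Finset.range i, q ^ (j - l) ≤ 2 := by
        have hre : ∑ l ∈ Finset.range i, q ^ (j - l) ≤ ∑ k ∈ Finset.range (j + 1), q ^ k := by
          calc ∑ l ∈ Finset.range i, q ^ (j - l) ≤ ∑ l ∈ Finset.range (j + 1), q ^ (j - l) :=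
                Finset.sum_le_sum_of_subset_of_nonneg (Finset.range_mono (by omega)) fun _ _ _ => pow_nonneg hq0 _
            _ = ∑ k ∈ Finset.range (j + 1), q ^ k := by
                rw [← Finset.sum_range_reflect]
                refine Finset.sum_congr rfl fun k hk => ?_
                have := Finset.mem_range.mp hk; congr 1; omega
        exact hre.trans (NE7RadIterUniform.geom_sum_le_two hq0 (by linarith) (j + 1))
      simp only [hg]
      rw [← Finset.mul_sum]
      nlinarith [mul_nonneg hε hq0]
    have hLmC : 0 ≤ mC 4 L ν / (L : ℝ)⁻¹ := by positivity
    calc mC 4 L ν / (L : ℝ)⁻¹ * ∑ l ∈ Finset.range i, g l ≤ mC 4 L ν / (L : ℝ)⁻¹ * (2 * ε * (2 * q)) := mul_le_mul_of_nonneg_left hgsum hLmC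
      _ = 8 * (L : ℝ) * mC 4 L ν * ε * q / 2 := by rw [div_inv_eq_mul]; ring
      _ ≤ 1 / 2 := by rw [hq]; linarith
      _ ≤ 1 := by norm_num
  have hprod : ∀ i ∈ Finset.range (j + 1), ∏ l ∈ Finset.range i, ((L : ℝ)⁻¹ + mC 4 L ν * g l) ≤ ((L : ℝ)⁻¹) ^ i * 3 := by
    intro i hi
    have hi' : i ≤ j + 1 := by have := Finset.mem_range.mp hi; omega
    refine (prod_add_le_pow_mul_exp (by positivity) hmC g hg0 i).trans (mul_le_mul_of_nonneg_left ?_ (by positivity))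
    calc Real.exp (mC 4 L ν / (L : ℝ)⁻¹ * ∑ l ∈ Finset.range i, g l) ≤ Real.exp 1 := Real.exp_le_exp.mpr (hU i hi')
      _ ≤ 3 := Real.exp_one_lt_three.le
  calc ∑ i ∈ Finset.range (j + 1), eC 4 L ν * g i * ∏ l ∈ Finset.range i, ((L : ℝ)⁻¹ + mC 4 L ν * g l)
      ≤ ∑ i ∈ Finset.range (j + 1), eC 4 L ν * g i * (((L : ℝ)⁻¹) ^ i * 3) :=
        Finset.sum_le_sum fun i hi => mul_le_mul_of_nonneg_left (hprod i hi) (mul_nonneg heC (hg0 i))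
    _ = 6 * eC 4 L ν * ε * ∑ i ∈ Finset.range (j + 1), q ^ (j + 1 - i) * ((L : ℝ)⁻¹) ^ i := by
        simp only [hg, Finset.mul_sum]; exact Finset.sum_congr rfl fun i _ => by ring
    _ ≤ 6 * eC 4 L ν * ε * ((L : ℝ)⁻¹) ^ (j + 1) := mul_le_mul_of_nonneg_left (sum_geom_d4_le hLr j) (by positivity)

/-- **HEADLINE (d = 4)**: for `L ≥ 2`, `N ≥ 1`, the class radius `x = ε·L^{−2(j+1)}` under the three smallness lines (L- and `card n`-dependent only), every unitary `(tower L N (j+1))`-periodic `U`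
with `SmallField U x` and every `(tower L N (j+1))`-periodic `Y`:
`√(Σ_{P∈perWin N} nhsNormSq (curl (cavgIter L (j+1) U) (QbarIter L (j+1) U Y) P)) ≤ √(Σ_{p∈perWin (tower L N (j+1))} nhsNormSq (curl U Y p)) + 6·eC 4 L ν·ε·(L⁻¹)^{j+1}·√(Σ_b Σ_κ nhsNormSq (Y b κ))`
(`ν = card n`) — the straight tower's coarse Maxwell energy is the fine one up to `O(ε)` times the SCALED fine mass, UNIFORMLY in `j` and `N`. [cite: Balaban1985Averaging, (48) p.25, (120) p.35] -/
theorem sqrt_curl_energy_QbarIter_le_class_d4 [Nonempty n] {L N : ℕ} [NeZero L] (hL : 2 ≤ L) (hN : 1 ≤ N) {ε : ℝ} (hε : 0 ≤ ε)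
    (hεD : 4 * ε * radD 4 L * (((L : ℝ) ^ 2)⁻¹) ^ 2 ≤ 1) (hεT : twoLevelSmall 4 L * (2 * ε * ((L : ℝ) ^ 2)⁻¹) ≤ 1)
    (hεM : 8 * (L : ℝ) * mC 4 L (Fintype.card n) * ε * ((L : ℝ) ^ 2)⁻¹ ≤ 1) (j : ℕ)
    {U : Site 4 → Fin 4 → (Matrix n n ℂ)ˣ} (hU : IsUnitaryCfg U) (hUP : IsPeriodicCfg U ((tower L N (j + 1) : ℕ) : ℤ))
    (hUx : SmallField U (ε * (((L : ℝ) ^ 2)⁻¹) ^ (j + 1)))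
    {Y : Site 4 → Fin 4 → Matrix n n ℂ} (hYP : IsPeriodicDir Y ((tower L N (j + 1) : ℕ) : ℤ)) :
    Real.sqrt (∑ P ∈ perWin 4 N, nhsNormSq (curl (cavgIter L (j + 1) U) (QbarIter L (j + 1) U Y) P))
      ≤ Real.sqrt (∑ p ∈ perWin 4 (tower L N (j + 1)), nhsNormSq (curl U Y p))
        + 6 * eC 4 L (Fintype.card n) * ε * ((L : ℝ)⁻¹) ^ (j + 1) * Real.sqrt (∑ b ∈ periodBox (tower L N (j + 1)), ∑ κ : Fin 4, nhsNormSq (Y b κ)) := by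
  have hL1 : 1 ≤ L := by omega
  have hx0 : 0 ≤ ε * (((L : ℝ) ^ 2)⁻¹) ^ (j + 1) := by positivity
  obtain ⟨hsm, -⟩ := levelSmall_of_class_radius (d := 4) hL hε hεD hεT j
  have h := sqrt_curl_energy_QbarIter_le (d := 4) hL1 hN j hU hUP hx0 hsm hUx hYP
  have hLne : (L : ℝ) ≠ 0 := by exact_mod_cast (show L ≠ 0 by omega)
  have hρE : Real.sqrt ((L : ℝ) ^ 4 / (L : ℝ) ^ 4) = 1 := by rw [div_self (pow_ne_zero 4 hLne), Real.sqrt_one]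
  rw [hρE, one_pow, one_mul] at h
  refine h.trans (add_le_add le_rfl (mul_le_mul_of_nonneg_right (towerB_class_le hL hε hεD hεT hεM j) (Real.sqrt_nonneg _)))

end

end Summit.QuantumFields.BalabanUV.T4Continuum.NE7StraightTowerCurlEnergyD4
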